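import Literature.Analysis.FunctionSpaces.TorusSobolevNorm
import Mathlib.NumberTheory.Transcendental.Liouville.LiouvilleNumber
import HarnessLib

/-!
# Liouville laminar states II: resonant frequencies, force and response coefficients
(solo-informed)

Number-theoretic and algebraic data for `SoloInformedLiouvilleStates`.  With
`θ = liouvilleNumber 2 = ∑_i 2^{-i!}`, `b_n = 2^{(n+2)!}`, `a_n/b_n` the `(n+2)`-nd partial sum,
the small divisors `s_n = b_n θ - a_n` satisfy `0 < s_n < b_n^{-(n+1)}` (Mathlib
`LiouvilleNumber.remainder_pos/remainder_lt`); the resonant frequencies are `k_n = (b_n, a_n) ∈ ℤ²`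
and the drift `c = (-θ, 1)` has `c·k_n = -s_n`.  Symbols: `σ_n = -2π s_n` (drift),
`λ_n = 4π²|k_n|²` (Laplacian); force amplitudes `w_n = 2π s_n 2^{-n}`; response
`z_n(ν) = w_n/(iσ_n + νλ_n)` with `|z_n(ν)| ≤ 2^{-n}` for every `ν` and `≤ w_n/ν` for `ν > 0`;
rapid decay `∑_n w_n (2π(1+|k_n|²))^m < ∞` (for `n ≥ 2m` the term is `≤ 2π(2π(2+θ²))^m 4^{-n}`);
resonant viscosities `ν_n = |σ_n|/λ_n → 0`.  References: J. Liouville (1851) / Mathlib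
`LiouvilleNumber`; L. Grafakos (2014) Prop. 3.3.12 [Grafakos2014].
-/

noncomputable section

open Filter Topology
open scoped Real

namespace Summit.AnomalousDissipation.AnomalousDissipation.Theorems

open Literature.Analysis.FunctionSpaces Literature.Analysis.FunctionSpaces.Torus

/-! ## Liouville resonant frequencies -/

section LiouvilleData

open LiouvilleNumber

/-- `θ = ∑_i 2^{-i!}`, Liouville's constant in base `2`. [folklore] -/
def θL : ℝ := liouvilleNumber ((2 : ℕ) : ℝ)

/-- Denominators `b_n = 2^{(n+2)!}`. [folklore] -/
def bL (n : ℕ) : ℕ := 2 ^ (n + 2).factorial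

/-- The `(n+2)`-nd partial sum of `θ` is a fraction with denominator `b_n`
(Mathlib `LiouvilleNumber.partialSum_eq_rat`). [folklore] -/
theorem exists_aL (n : ℕ) : ∃ p : ℕ, partialSum ((2 : ℕ) : ℝ) (n + 2) = p / (bL n : ℝ) := by
  obtain ⟨p, hp⟩ := partialSum_eq_rat (m := 2) two_pos (n + 2)
  exact ⟨p, by rw [hp, bL, Nat.cast_pow]⟩

/-- Numerators `a_n`: `a_n / b_n` is the `(n+2)`-nd partial sum of `θ`. [folklore] -/
def aL (n : ℕ) : ℕ := Classical.choose (exists_aL n)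

/-- Defining property of `a_n`: `a_n/b_n` is the `(n+2)`-nd partial sum of `θ`. [folklore] -/
theorem aL_spec (n : ℕ) : partialSum ((2 : ℕ) : ℝ) (n + 2) = aL n / (bL n : ℝ) :=
  Classical.choose_spec (exists_aL n)

/-- The small divisors `s_n = b_n θ - a_n`. [folklore] -/
def sL (n : ℕ) : ℝ := (bL n : ℝ) * θL - aL n

/-- `0 < b_n` and `1 ≤ b_n` (as real numbers). [folklore] -/
theorem bL_bounds (n : ℕ) : (0 : ℝ) < bL n ∧ (1 : ℝ) ≤ bL n :=
  ⟨Nat.cast_pos.2 (by unfold bL; positivity), by exact_mod_cast (Nat.one_le_two_pow : 1 ≤ bL n)⟩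

/-- `(n+2)! ≥ 2(n+1)`. [folklore] -/
theorem two_mul_le_factorial (n : ℕ) : 2 * (n + 1) ≤ (n + 2).factorial := by
  rw [Nat.factorial_succ]
  exact Nat.mul_le_mul (by omega) (Nat.self_le_factorial _)

/-- `b_n ≥ 4^{n+1}`. [folklore] -/
theorem four_pow_le_bL (n : ℕ) : (4 : ℝ) ^ (n + 1) ≤ bL n := by
  have h : 4 ^ (n + 1) ≤ bL n := by
    unfold bL
    calc 4 ^ (n + 1) = 2 ^ (2 * (n + 1)) := by rw [pow_mul]; norm_num
      _ ≤ 2 ^ (n + 2).factorial := Nat.pow_le_pow_right two_pos (two_mul_le_factorial n)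
  exact_mod_cast h

/-- `n ↦ b_n` is injective. [folklore] -/
theorem bL_injective : Function.Injective bL := by
  intro m n h
  unfold bL at h
  have h1 := Nat.pow_right_injective le_rfl h
  have h2 := (Nat.factorial_inj (n := m + 2) (by omega)).1 h1
  omega

/-- `s_n = b_n · (tail of θ after n+2 terms)`. [folklore] -/
theorem sL_eq (n : ℕ) : sL n = bL n * remainder ((2 : ℕ) : ℝ) (n + 2) := by
  have h := partialSum_add_remainder (m := ((2 : ℕ) : ℝ)) (by norm_num) (n + 2)
  rw [sL, θL, ← h, aL_spec, mul_add, mul_div_cancel₀ _ ((bL_bounds n).1).ne']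
  ring

/-- `s_n > 0` (the tail of `θ` is positive). [folklore] -/
theorem sL_pos (n : ℕ) : 0 < sL n := by
  rw [sL_eq]; exact mul_pos ((bL_bounds n).1) (remainder_pos (by norm_num) _)

/-- **Liouville's estimate**: `s_n < b_n^{-(n+1)}`. [folklore] -/
theorem sL_lt (n : ℕ) : sL n < ((bL n : ℝ) ^ (n + 1))⁻¹ := by
  rw [sL_eq]
  have h := remainder_lt (n + 2) (m := ((2 : ℕ) : ℝ)) (by norm_num)
  have hb : ((2 : ℕ) : ℝ) ^ (n + 2).factorial = (bL n : ℝ) := by rw [bL, Nat.cast_pow]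
  rw [hb] at h
  have hb0 := (bL_bounds n).1
  calc (bL n : ℝ) * remainder ((2 : ℕ) : ℝ) (n + 2) < bL n * (1 / (bL n : ℝ) ^ (n + 2)) :=
        mul_lt_mul_of_pos_left h hb0
    _ = ((bL n : ℝ) ^ (n + 1))⁻¹ := by
        rw [pow_succ]; field_simp

/-- `s_n < 1/b_n`. [folklore] -/
theorem sL_lt_one_div_bL (n : ℕ) : sL n < (bL n : ℝ)⁻¹ := by
  refine (sL_lt n).trans_le ?_
  rw [inv_le_inv₀ (pow_pos ((bL_bounds n).1) _) ((bL_bounds n).1)]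
  exact le_self_pow₀ ((bL_bounds n).2) (by omega)

/-- `s_n < 1`. [folklore] -/
theorem sL_lt_one (n : ℕ) : sL n < 1 :=
  (sL_lt_one_div_bL n).trans_le (inv_le_one_of_one_le₀ ((bL_bounds n).2))

/-- `a_n < θ b_n`. [folklore] -/
theorem aL_lt (n : ℕ) : (aL n : ℝ) < θL * bL n := by
  have := sL_pos n; rw [sL] at this; linarith

/-- The resonant frequencies `k_n = (b_n, a_n) ∈ ℤ²`. [folklore] -/
def kL (n : ℕ) : Fin 2 → ℤ := ![(bL n : ℤ), (aL n : ℤ)]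

/-- First component of `k_n`. [folklore] -/
@[simp] theorem kL_zero (n : ℕ) : kL n 0 = bL n := rfl
/-- Second component of `k_n`. [folklore] -/
@[simp] theorem kL_one (n : ℕ) : kL n 1 = aL n := rfl

/-- `k_n ≠ 0`. [folklore] -/
theorem kL_ne_zero (n : ℕ) : kL n ≠ 0 := fun h => by
  have h0 := congrFun h 0
  simp only [kL_zero, Pi.zero_apply, Nat.cast_eq_zero] at h0
  exact absurd h0 (by unfold bL; positivity)

/-- `n ↦ k_n` is injective. [folklore] -/
theorem kL_injective : Function.Injective kL := by
  intro m n h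
  have h0 := congrFun h 0
  rw [kL_zero, kL_zero] at h0
  exact bL_injective (by exact_mod_cast h0)

/-- No resonant frequency is the negative of another (first components are positive). [folklore] -/
theorem kL_ne_neg (m n : ℕ) : kL m ≠ -kL n := by
  intro h
  have h0 := congrFun h 0
  rw [Pi.neg_apply, kL_zero, kL_zero] at h0
  have h1 := (bL_bounds m).1; have h2 := (bL_bounds n).1
  have : (bL m : ℝ) = -(bL n : ℝ) := by exact_mod_cast h0
  linarith

/-- `|k_n|² = b_n² + a_n²`. [folklore] -/
theorem freqNormSq_kL (n : ℕ) : freqNormSq (kL n) = (bL n : ℝ) ^ 2 + (aL n : ℝ) ^ 2 := by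
  simp [freqNormSq, Fin.sum_univ_two]

/-- `b_n² ≤ |k_n|²`. [folklore] -/
theorem bL_sq_le_freqNormSq (n : ℕ) : (bL n : ℝ) ^ 2 ≤ freqNormSq (kL n) := by
  rw [freqNormSq_kL]; nlinarith

/-- `1 + |k_n|² ≤ (2 + θ²) b_n²`. [folklore] -/
theorem one_add_freqNormSq_kL_le (n : ℕ) :
    1 + freqNormSq (kL n) ≤ (2 + θL ^ 2) * (bL n : ℝ) ^ 2 := by
  rw [freqNormSq_kL]
  have h1 := (bL_bounds n).2
  have h2 := aL_lt n
  have h3 : (0 : ℝ) ≤ aL n := Nat.cast_nonneg _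
  have h4 : (aL n : ℝ) ^ 2 ≤ (θL * bL n) ^ 2 := pow_le_pow_left₀ h3 h2.le 2
  nlinarith

/-- The Liouville drift direction `c = (-θ, 1)`. [folklore] -/
def cL : EuclideanSpace ℝ (Fin 2) := !₂[-θL, 1]

/-- First component of the drift `c`. [folklore] -/
@[simp] theorem cL_zero : cL 0 = -θL := rfl
/-- Second component of the drift `c`. [folklore] -/
@[simp] theorem cL_one : cL 1 = 1 := rfl

/-- **Small divisors**: `c · k_n = -s_n`. [folklore] -/
theorem sum_cL_mul_kL (n : ℕ) : ∑ j, cL j * (kL n j : ℝ) = -sL n := by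
  simp [Fin.sum_univ_two, sL]
  ring

end LiouvilleData

/-! ## The force and the laminar response, mode by mode -/

section Coefficients

/-- Drift symbol `σ_n = 2π c·k_n = -2π s_n`. [folklore] -/
def σL (n : ℕ) : ℝ := -(2 * Real.pi * sL n)

/-- Laplacian symbol `λ_n = 4π² |k_n|²`. [folklore] -/
def lamL (n : ℕ) : ℝ := 4 * Real.pi ^ 2 * freqNormSq (kL n)

/-- Force amplitudes `w_n = 2π s_n 2^{-n} = |σ_n| 2^{-n}`. [folklore] -/
def wL (n : ℕ) : ℝ := 2 * Real.pi * sL n * (1 / 2) ^ n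

/-- The symbol `iσ_n + νλ_n` of `c·∇ - νΔ` on the mode `k_n`. [folklore] -/
def den (ν : ℝ) (n : ℕ) : ℂ := (σL n : ℂ) * Complex.I + ((ν * lamL n : ℝ) : ℂ)

/-- Response coefficients `z_n(ν) = w_n / (iσ_n + νλ_n)`. [folklore] -/
def zL (ν : ℝ) (n : ℕ) : ℂ := (wL n : ℂ) / den ν n

/-- `σ_n ≠ 0`. [folklore] -/
theorem σL_ne_zero (n : ℕ) : σL n ≠ 0 := by
  have := sL_pos n; unfold σL; intro h; nlinarith [Real.pi_pos]

/-- `|σ_n| = 2π s_n`. [folklore] -/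
theorem abs_σL (n : ℕ) : |σL n| = 2 * Real.pi * sL n := by
  rw [σL, abs_neg, abs_of_pos (by have := sL_pos n; positivity)]

/-- `w_n > 0`. [folklore] -/
theorem wL_pos (n : ℕ) : 0 < wL n := by have := sL_pos n; unfold wL; positivity

/-- `w_n = |σ_n| 2^{-n}`. [folklore] -/
theorem wL_eq (n : ℕ) : wL n = |σL n| * (1 / 2) ^ n := by rw [abs_σL, wL]

/-- `λ_n > 0`. [folklore] -/
theorem lamL_pos (n : ℕ) : 0 < lamL n := by
  unfold lamL
  have := bL_sq_le_freqNormSq n; have := (bL_bounds n).1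
  have : 0 < freqNormSq (kL n) := by nlinarith
  positivity

/-- `λ_n ≥ 1`. [folklore] -/
theorem one_le_lamL (n : ℕ) : 1 ≤ lamL n := by
  unfold lamL
  have h1 := bL_sq_le_freqNormSq n; have h2 := (bL_bounds n).2
  have h3 : (1 : ℝ) ≤ freqNormSq (kL n) := by nlinarith
  have h4 : (1 : ℝ) ≤ 4 * Real.pi ^ 2 := by nlinarith [Real.two_le_pi]
  nlinarith

/-- `Im (iσ_n + νλ_n) = σ_n`. [folklore] -/
theorem den_im (ν : ℝ) (n : ℕ) : (den ν n).im = σL n := by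
  simp [den, Complex.mul_im]

/-- `Re (iσ_n + νλ_n) = νλ_n`. [folklore] -/
theorem den_re (ν : ℝ) (n : ℕ) : (den ν n).re = ν * lamL n := by
  simp [den, Complex.mul_re]

/-- The symbol `iσ_n + νλ_n` never vanishes (its imaginary part is `σ_n ≠ 0`), for every real
`ν`. [folklore] -/
theorem den_ne_zero (ν : ℝ) (n : ℕ) : den ν n ≠ 0 := by
  intro h
  have := den_im ν n
  rw [h, Complex.zero_im] at this
  exact σL_ne_zero n this.symm

/-- `|σ_n| ≤ |iσ_n + νλ_n|`. [folklore] -/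
theorem abs_σL_le_norm_den (ν : ℝ) (n : ℕ) : |σL n| ≤ ‖den ν n‖ := by
  rw [← den_im ν n]; exact Complex.abs_im_le_norm _

/-- `νλ_n ≤ |iσ_n + νλ_n|`. [folklore] -/
theorem norm_den_ge_re (ν : ℝ) (n : ℕ) : ν * lamL n ≤ ‖den ν n‖ := by
  rw [← den_re ν n]; exact Complex.re_le_norm _

/-- The response solves the mode equation: `(iσ_n + νλ_n) z_n(ν) = w_n`. [folklore] -/
theorem den_mul_zL (ν : ℝ) (n : ℕ) : den ν n * zL ν n = wL n := by
  rw [zL, mul_div_cancel₀ _ (den_ne_zero ν n)]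

/-- **Uniform smallness of the response**: `|z_n(ν)| ≤ w_n/|σ_n| = 2^{-n}` for every `ν`.
[folklore] -/
theorem norm_zL_le (ν : ℝ) (n : ℕ) : ‖zL ν n‖ ≤ (1 / 2) ^ n := by
  rw [zL, norm_div, Complex.norm_real, Real.norm_eq_abs, abs_of_pos (wL_pos n), wL_eq]
  have hσ : 0 < |σL n| := abs_pos.2 (σL_ne_zero n)
  rw [div_le_iff₀ (hσ.trans_le (abs_σL_le_norm_den ν n))]
  calc |σL n| * (1 / 2) ^ n ≤ ‖den ν n‖ * (1 / 2) ^ n :=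
      mul_le_mul_of_nonneg_right (abs_σL_le_norm_den ν n) (by positivity)
    _ = (1 / 2) ^ n * ‖den ν n‖ := mul_comm _ _

/-- For `ν > 0`: `|z_n(ν)| ≤ w_n/(νλ_n) ≤ w_n/ν`. [folklore] -/
theorem norm_zL_le_of_pos {ν : ℝ} (hν : 0 < ν) (n : ℕ) : ‖zL ν n‖ ≤ wL n / ν := by
  rw [zL, norm_div, Complex.norm_real, Real.norm_eq_abs, abs_of_pos (wL_pos n)]
  have h1 : ν ≤ ‖den ν n‖ := by
    refine le_trans ?_ (norm_den_ge_re ν n)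
    have := one_le_lamL n; nlinarith
  exact div_le_div_of_nonneg_left (wL_pos n).le hν h1

/-- The Sobolev weights `(2π(1+|k_n|²))^m` are non-negative. [folklore] -/
theorem weight_pow_nonneg (n m : ℕ) : 0 ≤ (2 * Real.pi * (1 + freqNormSq (kL n))) ^ m :=
  pow_nonneg (by have := freqNormSq_nonneg (kL n); positivity) m

/-- **Rapid decay of the force coefficients** (`h ∈ C^∞`): for `n ≥ 2m`,
`w_n (2π(1+|k_n|²))^m ≤ 2π (2π(2+θ²))^m (1/4)^n`. [folklore] -/
theorem wL_mul_pow_le {m n : ℕ} (hn : 2 * m ≤ n) :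
    wL n * (2 * Real.pi * (1 + freqNormSq (kL n))) ^ m ≤
      2 * Real.pi * (2 * Real.pi * (2 + θL ^ 2)) ^ m * (1 / 4) ^ n := by
  have hπ : 0 < Real.pi := Real.pi_pos
  have hb := (bL_bounds n).1
  have hb1 := (bL_bounds n).2
  have hs := sL_pos n
  have h1 : (2 * Real.pi * (1 + freqNormSq (kL n))) ^ m ≤
      (2 * Real.pi * (2 + θL ^ 2)) ^ m * ((bL n : ℝ) ^ 2) ^ m := by
    rw [← mul_pow]
    refine pow_le_pow_left₀ (by have := freqNormSq_nonneg (kL n); positivity) ?_ m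
    have := one_add_freqNormSq_kL_le n
    nlinarith
  have h2 : wL n ≤ 2 * Real.pi * sL n := by
    unfold wL
    have : (1 / 2 : ℝ) ^ n ≤ 1 := pow_le_one₀ (by norm_num) (by norm_num)
    exact mul_le_of_le_one_right (by positivity) this
  have h3 : sL n * ((bL n : ℝ) ^ 2) ^ m ≤ (bL n : ℝ)⁻¹ := by
    have h4 := sL_lt n
    have h5 : ((bL n : ℝ) ^ 2) ^ m * (bL n : ℝ) ≤ (bL n : ℝ) ^ (n + 1) := by
      rw [← pow_mul, ← pow_succ]
      exact pow_le_pow_right₀ hb1 (by omega)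
    calc sL n * ((bL n : ℝ) ^ 2) ^ m ≤ ((bL n : ℝ) ^ (n + 1))⁻¹ * ((bL n : ℝ) ^ 2) ^ m :=
          mul_le_mul_of_nonneg_right h4.le (by positivity)
      _ ≤ (bL n : ℝ)⁻¹ := by
          rw [inv_mul_le_iff₀ (pow_pos hb _), le_mul_inv_iff₀ hb]
          exact h5
  have h6 : (bL n : ℝ)⁻¹ ≤ (1 / 4) ^ n := by
    have h7 := four_pow_le_bL n
    rw [one_div, inv_pow]
    refine inv_anti₀ (by positivity) (le_trans ?_ h7)
    rw [pow_succ]; nlinarith [pow_pos (by norm_num : (0:ℝ) < 4) n]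
  calc wL n * (2 * Real.pi * (1 + freqNormSq (kL n))) ^ m
      ≤ (2 * Real.pi * sL n) * ((2 * Real.pi * (2 + θL ^ 2)) ^ m * ((bL n : ℝ) ^ 2) ^ m) :=
        mul_le_mul h2 h1 (weight_pow_nonneg n m) (by positivity)
    _ = 2 * Real.pi * (2 * Real.pi * (2 + θL ^ 2)) ^ m * (sL n * ((bL n : ℝ) ^ 2) ^ m) := by ring
    _ ≤ 2 * Real.pi * (2 * Real.pi * (2 + θL ^ 2)) ^ m * (bL n : ℝ)⁻¹ :=
        mul_le_mul_of_nonneg_left h3 (by positivity)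
    _ ≤ 2 * Real.pi * (2 * Real.pi * (2 + θL ^ 2)) ^ m * (1 / 4) ^ n :=
        mul_le_mul_of_nonneg_left h6 (by positivity)

/-- The force coefficients decay rapidly:
`∑_n |w_n| (2π(1+|k_n|²))^m < ∞` for every `m`. [cite: Grafakos2014, Prop. 3.3.12] -/
theorem summable_wL_weight (m : ℕ) :
    Summable fun n => ‖(wL n : ℂ)‖ * (2 * Real.pi * (1 + freqNormSq (kL n))) ^ m := by
  refine Summable.of_norm_bounded_eventually
    (g := fun n => 2 * Real.pi * (2 * Real.pi * (2 + θL ^ 2)) ^ m * (1 / 4 : ℝ) ^ n)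
    ((summable_geometric_of_lt_one (by norm_num) (by norm_num)).mul_left _) ?_
  rw [Nat.cofinite_eq_atTop, Filter.eventually_atTop]
  refine ⟨2 * m, fun n hn => ?_⟩
  rw [Real.norm_eq_abs, abs_of_nonneg (mul_nonneg (norm_nonneg _) (weight_pow_nonneg n m)),
    Complex.norm_real, Real.norm_eq_abs, abs_of_pos (wL_pos n)]
  exact wL_mul_pow_le hn

/-- The response coefficients decay rapidly for every `ν > 0`. [cite: Grafakos2014, Prop. 3.3.12] -/
theorem summable_zL_weight {ν : ℝ} (hν : 0 < ν) (m : ℕ) :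
    Summable fun n => ‖zL ν n‖ * (2 * Real.pi * (1 + freqNormSq (kL n))) ^ m := by
  refine Summable.of_nonneg_of_le (fun n => mul_nonneg (norm_nonneg _) (weight_pow_nonneg n m))
    (fun n => ?_) ((summable_wL_weight m).mul_left ν⁻¹)
  rw [Complex.norm_real, Real.norm_eq_abs, abs_of_pos (wL_pos n), ← mul_assoc]
  refine mul_le_mul_of_nonneg_right ?_ (weight_pow_nonneg n m)
  rw [inv_mul_eq_div]
  exact norm_zL_le_of_pos hν n

/-- `∑_n |z_n(ν)| < ∞`, for every `ν`. [folklore] -/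
theorem summable_norm_zL (ν : ℝ) : Summable fun n => ‖zL ν n‖ :=
  Summable.of_nonneg_of_le (fun n => norm_nonneg _) (norm_zL_le ν)
    (summable_geometric_of_lt_one (by norm_num) (by norm_num))

/-- `∑_n |z_n(ν)| ≤ 2`, for every `ν`. [folklore] -/
theorem tsum_norm_zL_le (ν : ℝ) : ∑' n, ‖zL ν n‖ ≤ 2 := by
  calc ∑' n, ‖zL ν n‖ ≤ ∑' n : ℕ, (1 / 2 : ℝ) ^ n :=
        (summable_norm_zL ν).tsum_le_tsum (norm_zL_le ν) summable_geometric_two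
    _ = 2 := tsum_geometric_two

end Coefficients

/-! ## The resonant viscosities -/

/-- The resonant viscosities `ν_n = |σ_n|/λ_n` (so that `ν_n λ_n = |σ_n|`). [folklore] -/
def νL (n : ℕ) : ℝ := |σL n| / lamL n

/-- `ν_n > 0`. [folklore] -/
theorem νL_pos (n : ℕ) : 0 < νL n := div_pos (abs_pos.2 (σL_ne_zero n)) (lamL_pos n)

/-- `1/b_n ≤ 4^{-n}`. [folklore] -/
theorem inv_bL_le (n : ℕ) : (bL n : ℝ)⁻¹ ≤ (1 / 4 : ℝ) ^ n := by
  have h7 := four_pow_le_bL n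
  rw [one_div, inv_pow]
  refine inv_anti₀ (by positivity) (le_trans ?_ h7)
  rw [pow_succ]; nlinarith [pow_pos (by norm_num : (0 : ℝ) < 4) n]

/-- `ν_n ≤ 2π 4^{-n}`. [folklore] -/
theorem νL_le (n : ℕ) : νL n ≤ 2 * Real.pi * (1 / 4 : ℝ) ^ n := by
  have h1 : νL n ≤ |σL n| := div_le_self (abs_nonneg _) (one_le_lamL n)
  rw [abs_σL] at h1
  have h2 := (sL_lt_one_div_bL n).le.trans (inv_bL_le n)
  nlinarith [Real.pi_pos]

/-- `ν_n → 0`. [folklore] -/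
theorem tendsto_νL : Tendsto νL atTop (𝓝 0) := by
  refine squeeze_zero (fun n => (νL_pos n).le) νL_le ?_
  have h := (tendsto_pow_atTop_nhds_zero_of_lt_one (by norm_num : (0 : ℝ) ≤ 1 / 4)
    (by norm_num)).const_mul (2 * Real.pi)
  rwa [mul_zero] at h

end Summit.AnomalousDissipation.AnomalousDissipation.Theorems

end
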